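import Summits.NavierStokesRegularity.NavierStokesRegularity.Theorems.FilamentSkeletonRssSkeletonJ1RSplit
import Summits.NavierStokesRegularity.NavierStokesRegularity.Theorems.FilamentSkeletonRssNormalBlockMatchedL
import Summits.NavierStokesRegularity.NavierStokesRegularity.Theorems.FilamentSkeletonRssClause13RImp

/-!
# Route `FilamentSkeletonRss` · crux `SkeletonJ1R` (stmt-NavierStokesRegularity-23610) — ALTERNATIVE SKELETON LINE `adjoint_rate_R`

Crux-strategist `cstrat-stmt-NavierStokesRegularity-23610-s1` (2026-08-29).  An ALTERNATIVE line: it does not replace the BC3 skeleton of record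
`filament-plan/lines/SkeletonJ1R/near_straight_newton_R.lean` (v1, sha256 6e5316ef…; stubs `stub_tangentSkeletonL` 23320 · `stub_clause13R` 23612,
piece 3 and the glue 23614 by name) and touches none of the children's files.  Same decomposition of the parent (landed glue
`Theorems.FilamentSkeletonRssSkeletonJ1RSplit.skeletonJ1R_of_children`, p673130), the heart 23320 BY NAME; what is new is the CUT OF THE CLAUSE-13-R
PIECE along its bordered structure, with a sorry-free glue:

  `Clause13RNearStraightL (23612)  ⟸  (J∘) Clause13InBallNearStraightLS  ∧  (ρ) BallRateRowNearStraightLS`   — `clause13R_of_inBall_of_rate` (§3).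

* (J∘) IN-BALL WEIGHTED INJECTIVITY = clause 13-R with the rate increment frozen to `dα = 0`: literally the sub-case of item 23612 that the lane's
  in-ball brick programme (DESIGN-NOTE-28296 §4–§5) addresses; exponent `0 ≤ a` exactly as there (calibration `a = 0`).
* (ρ) THE RATE ROW ALONE, AT BALL SCALE: for the same admissible variations `Y` and every `dα`, an in-ball bound `L` on the bordered defect
  `DT·Y − dα·R_j` (exponent `a = 0`) forces `|dα| · R_b√(Γ log Γ) ≤ cα · L` — nothing is concluded about `Y`, and the bound holds for EVERY envelope
  exponent `b` because the mechanism never measures `Y`: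
  MECHANISM (the lever; LINE CARD `Lines/adjoint_rate_R.md`): for ball-supported `C²` variations the Lagrange identity
  `Σ_j ∫_ball ⟨ψ_j, (DT·Y)_j⟩ = Σ_j ∫_ball ⟨(DT_ball^* ψ)_j, Y_j⟩` is EXACT (no boundary terms: `Y = Y′ = 0` at the ball's edge), so every exact
  in-ball ADJOINT ANNIHILATOR `ψ` (an element of the cokernel of the clamped in-ball operator — a space of dimension ≥ 4N by the index count) gives
  `dα · ψ(R) = −ψ(DT·Y − dα R)` and hence `|dα| ≤ L‖ψ‖_{L¹} / |ψ(R)|`.  In the ball, for `R_b ≤ c√(θ₀/Λ)`, the clamped linearisation is DOMINATED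
  by the straight-filament rigid-core self-induction operator `D` (dispersive, symbol `(Γγ_j/4πr_c²)·m(k r_c)`, `m(κ) = ∫(1 − cos κu − κu sin κu)(u²+1)^{-3/2}du
  ≈ −2κ² log(1/κ)` for `κ ≪ 1`, sign change at `κ* ≈ 1.1`, `→ 2`; at ball scale `|D| ≈ γ_j/(4πR_b²)` against transport/strain `O(Λ)`), whose adjoint
  annihilates exactly the AFFINE normal fields (infinitesimal rigid motions; the rigid matched core of Variant A1L makes this exact on
  `‖X‖ ≤ 2R_b√(Γ log Γ)`); exact annihilators of the full clamped operator are affine in the bulk up to `O(R_b)` and edge layers, and pairing the tilt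
  annihilator `ψ_j = (τ − c_j)·R₁ʲ`, `R₁ʲ = e₃ × X_j′(c_j)`, `‖R₁ʲ‖ ≥ s₀ := √(1 − (1−θ₀)²)` (the route's EXISTING tilt clause), against
  `R_j ≈ R₀ʲ + (τ−c_j)R₁ʲ` gives `|ψ(R)| ≳ ℓ³ s₀²` with `‖ψ‖_{L¹} ~ ℓ²`, `ℓ = R_b√(Γ log Γ)`: `|dα|·ℓ ≤ C L / s₀²`.
  Energy/virial identities cannot see `D` (`⟨J∂²Y, Y⟩ = 0`); the cokernel pairing does — that is the point of the line.
* GLUE (§3, sorry-free, elementary): given 13-R's hypotheses with `a := 0`, (ρ) bounds `|dα|ℓ ≤ cα L`; the rate forcing left in the column equation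
  is `dα·R_j(τ)` with `‖R_j(τ)‖ ≤ 2‖X_j(τ)‖ ≤ 2ℓ` at in-ball stations, so `DT·Y` obeys an in-ball defect bound `L(1+2cα)` and (J∘) bounds `Y`;
  `|dα|√Γ ≤ |dα|ℓ` once `Γ ≥ exp(R_b^{-2})`; `0 ≤ L` because the waist station lies in the ball (`Γ ≥ exp((R_w/R_b)²)`).  Delivered constants:
  `a := 0`, `b := b_J`, `cnd := max (cnd_J (1+2cα)) cα`, `R_b0 := min`, `Γ ≥ max (max Γ₀ Γ₁) (max 1 (max (exp((R_w/R_b)²)) (exp(R_b^{-2}))))`.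

REGISTERED-STYLE STUBS (the only `sorry`s): `stub_tangentSkeletonL` (23320, by name, XL — the heart, shared with the record), `stub_clause13InBall`
(J∘, M–L), `stub_ballRateRow` (ρ, L: nonlocal edge layers).  `stub_normalBlockL` is the landed theorem (p667604).  `SkeletonJ1R_of` concludes the crux
BY NAME through `skeletonJ1R_of_children` and the landed certificate `route_clause13RNearStraightL_iff`.
NOT REGISTERED on the item (`ledger skeleton check` has no `--alt`; the record stays the record): published as a crux workfile + evidence.
HONEST FRAMING: MODEL rung, NEGATIVE side of the ladder (a hypothetical filament-type rotating self-similar blow-up skeleton); nothing here proves or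
refutes any item; nothing bears on Navier–Stokes regularity.  If the tenure executes the pending A1R-acc retype (23610 → aside), §1–§3 transfer verbatim
to the clause-13-R piece, which stays member-wise.
-/

set_option linter.dupNamespace false
set_option linter.unusedVariables false

noncomputable section

namespace Summit.NavierStokesRegularity.NavierStokesRegularity.Cruxes.SkeletonJ1R.AdjointRateR

open scoped BigOperators Topology InnerProductSpace
open Filter Set Function MeasureTheory
open Literature.Analysis.FluidPDE
open Summit.NavierStokesRegularity.NavierStokesRegularity.Theses.FilamentSkeletonRss
open Summit.NavierStokesRegularity.NavierStokesRegularity.Theorems.FilamentSkeletonRssSkeletonJ1GSplit (NearStraightJ1G)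
open Summit.NavierStokesRegularity.NavierStokesRegularity.Theorems.FilamentSkeletonRssSkeletonJ1LSplit (FlatJ1L)
open Summit.NavierStokesRegularity.NavierStokesRegularity.Theorems.FilamentSkeletonRssSkeletonJ1RSplit
  (Clause13RJ1L Clause13RNearStraightLS route_clause13RNearStraightL_iff skeletonJ1R_of_children)

/-! ## §1  The two pieces of clause 13-R, typed (same raw vocabulary as the route file; `u v A T` bound by the crux's defining equations) -/

/-- PIECE (J∘) predicate · IN-BALL WEIGHTED INJECTIVITY (clause 13-R at `dα = 0`): for every `C²`, normal, ball-supported, phase-orthogonal variation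
`Y` with polynomial envelope `(1+|τ−c_j|)^b`, an IN-BALL bound `‖DT·Y‖ ≤ L(1+|τ−c_j|)^a` forces `‖Y‖ ≤ cnd·L·(1+|τ−c_j|)^b`.  Literally the route's
`Clause13RJ1L` with the rate increment `dα` frozen to `0` (cf. `Theorems.skeletonJ1R_imp_skeletonJ1L`), i.e. the 13-J tail with the defect premise
restricted to in-ball stations. (route-posited stub statement; not a Literature fact) -/
def Clause13InBallJ1L (N : ℕ) (a b cnd Rb Γ : ℝ) (γ : Fin N → ℝ) (α : ℝ) (X : Fin N → ℝ → EuclideanSpace ℝ (Fin 3)) (_w : Fin N → ℝ → ℝ)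
    (c : Fin N → ℝ) (Aa : Fin N → ℝ → ℝ) : Prop :=
  ∀ (u:(Fin N → ℝ → EuclideanSpace ℝ (Fin 3)) → EuclideanSpace ℝ (Fin 3) → EuclideanSpace ℝ (Fin 3)) (v:EuclideanSpace ℝ (Fin 3) → EuclideanSpace ℝ (Fin 3)) (A:Fin N → (EuclideanSpace ℝ (Fin 3) →L[ℝ] EuclideanSpace ℝ (Fin 3))) (T:(Fin N → ℝ → EuclideanSpace ℝ (Fin 3)) → Fin N → ℝ → EuclideanSpace ℝ (Fin 3)), (∀ Z y, u Z y = ∑ k, (Γ*γ k/(4*Real.pi))•∫ σ:ℝ, ((‖y-Z k σ‖^2+Real.exp (-(1+Real.eulerMascheroniConstant-Real.log 2))*Aa k σ)^(3/2:ℝ))⁻¹•cross (deriv (Z k) σ) (y-Z k σ))→(∀ y, v y = u X y+(1/2:ℝ)•y-α•cross (EuclideanSpace.single 2 1) y)→(∀ j, A j = fderiv ℝ v (X j (c j)))→(∀ Z j τ, T Z j τ = (u Z (Z j τ)+(1/2:ℝ)•Z j τ-α•cross (EuclideanSpace.single 2 1) (Z j τ))-(⟪u Z (Z j τ)+(1/2:ℝ)•Z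 j τ-α•cross (EuclideanSpace.single 2 1) (Z j τ), deriv (Z j) τ⟫_ℝ/‖deriv (Z j) τ‖^2)•deriv (Z j) τ)→(∀ Y:Fin N → ℝ → EuclideanSpace ℝ (Fin 3), (∀ j, ContDiff ℝ 2 (Y j))→(∀ j τ, ⟪Y j τ, deriv (X j) τ⟫_ℝ = 0) → (∀ j τ, Rb*√(Γ*Real.log Γ) < ‖X j τ‖ → Y j τ = 0) → ∑ j, ⟪Y j (c j), cross (EuclideanSpace.single 2 1) (X j (c j))⟫_ℝ = 0 → (∀ j τ, ‖Y j τ‖+‖deriv (Y j) τ‖+‖iteratedDeriv 2 (Y j) τ‖≤(1+|τ-c j|)^b) → ∀ L:ℝ, (∀ j τ, ‖X j τ‖≤Rb*√(Γ*Real.log Γ) → ‖deriv (fun s:ℝ => T (fun k σ => X k σ+s•Y k σ) j τ) 0‖≤L*(1+|τ-c j|)^a) → ∀ j τ, ‖Y j τ‖≤cnd*L*(1+|τ-c j|)^b)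

/-- PIECE (ρ) predicate · THE RATE ROW ALONE, AT BALL SCALE: for the same class of variations `Y` and every rate increment `dα`, an in-ball bound
`‖DT·Y − dα·R_j‖ ≤ L(1+|τ−c_j|)^a` on the BORDERED defect (`R_j = e₃×X_j − ⟪e₃×X_j, X_j′⟫X_j′`, the normal part of the `e₃`-rotation generator)
forces `|dα| · R_b√(Γ log Γ) ≤ cα·L` — nothing is concluded about `Y`.  (Used with `a = 0`.) (route-posited stub statement; not a Literature fact) -/
def BallRateRowJ1L (N : ℕ) (a b cα Rb Γ : ℝ) (γ : Fin N → ℝ) (α : ℝ) (X : Fin N → ℝ → EuclideanSpace ℝ (Fin 3)) (_w : Fin N → ℝ → ℝ)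
    (c : Fin N → ℝ) (Aa : Fin N → ℝ → ℝ) : Prop :=
  ∀ (u:(Fin N → ℝ → EuclideanSpace ℝ (Fin 3)) → EuclideanSpace ℝ (Fin 3) → EuclideanSpace ℝ (Fin 3)) (v:EuclideanSpace ℝ (Fin 3) → EuclideanSpace ℝ (Fin 3)) (A:Fin N → (EuclideanSpace ℝ (Fin 3) →L[ℝ] EuclideanSpace ℝ (Fin 3))) (T:(Fin N → ℝ → EuclideanSpace ℝ (Fin 3)) → Fin N → ℝ → EuclideanSpace ℝ (Fin 3)), (∀ Z y, u Z y = ∑ k, (Γ*γ k/(4*Real.pi))•∫ σ:ℝ, ((‖y-Z k σ‖^2+Real.exp (-(1+Real.eulerMascheroniConstant-Real.log 2))*Aa k σ)^(3/2:ℝ))⁻¹•cross (deriv (Z k) σ) (y-Z k σ))→(∀ y, v y = u X y+(1/2:ℝ)•y-α•cross (EuclideanSpace.single 2 1) y)→(∀ j, A j = fderiv ℝ v (X j (c j)))→(∀ Z j τ, T Z j τ = (u Z (Z j τ)+(1/2:ℝ)•Z j τ-α•cross (EuclideanSpace.single 2 1) (Z j τ))-(⟪u Z (Z j τ)+(1/2:ℝ)•Z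 j τ-α•cross (EuclideanSpace.single 2 1) (Z j τ), deriv (Z j) τ⟫_ℝ/‖deriv (Z j) τ‖^2)•deriv (Z j) τ)→(∀ Y:Fin N → ℝ → EuclideanSpace ℝ (Fin 3), (∀ j, ContDiff ℝ 2 (Y j))→(∀ j τ, ⟪Y j τ, deriv (X j) τ⟫_ℝ = 0) → (∀ j τ, Rb*√(Γ*Real.log Γ) < ‖X j τ‖ → Y j τ = 0) → ∑ j, ⟪Y j (c j), cross (EuclideanSpace.single 2 1) (X j (c j))⟫_ℝ = 0 → (∀ j τ, ‖Y j τ‖+‖deriv (Y j) τ‖+‖iteratedDeriv 2 (Y j) τ‖≤(1+|τ-c j|)^b) → ∀ dα L:ℝ, (∀ j τ, ‖X j τ‖≤Rb*√(Γ*Real.log Γ) → ‖deriv (fun s:ℝ => T (fun k σ => X k σ+s•Y k σ) j τ) 0-dα•(cross (EuclideanSpace.single 2 1) (X j τ)-⟪cross (EuclideanSpace.single 2 1) (X j τ), deriv (X j) τ⟫_ℝ•deriv (X j) τ)‖≤L*(1+|τ-c j|)^a) → |dα| * (Rb * √(Γ*Real.log Γ)) ≤ cα * L)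

/-- PIECE (J∘) · `Clause13InBallNearStraightLS` · in-ball weighted injectivity on the near-straight exactly tangent rigid-core family — the structured
form `Clause13RNearStraightLS` of item 23612 with `dα` frozen to `0`, quantifier prefix and exponent convention (`0 ≤ a`) unchanged. -/
def Clause13InBallNearStraightLS : Prop :=
  ∀ (N : ℕ) (δ ρ K Λ Rw cg θ₀ KA : ℝ), 0 < N → 0 < δ → 0 < ρ → 0 < Rw → 0 < cg → 0 < θ₀ →
    ∃ Rb₀ : ℝ, 0 < Rb₀ ∧ ∀ Rb : ℝ, 0 < Rb → Rb ≤ Rb₀ → ∃ (a b cnd Γ₀ : ℝ), 0 ≤ a ∧ 0 < cnd ∧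
      ∀ Γ : ℝ, Γ₀ ≤ Γ → ∀ (γ : Fin N → ℝ) (α : ℝ) (X : Fin N → ℝ → EuclideanSpace ℝ (Fin 3)) (w : Fin N → ℝ → ℝ)
        (c : Fin N → ℝ) (Aa : Fin N → ℝ → ℝ),
        FlatJ1L N δ ρ K Λ Rw Rb cg θ₀ KA Γ γ α X w c Aa → NearStraightJ1G N Λ Rb X w Aa →
          Clause13InBallJ1L N a b cnd Rb Γ γ α X w c Aa

/-- PIECE (ρ) · `BallRateRowNearStraightLS` · the ball-scale rate row with defect exponent `a = 0`, for EVERY envelope exponent `b`, on the near-straight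
exactly tangent rigid-core family, for `R_b ≤ R_b0(consts)` (bending dominance `R_b ≲ √(θ₀/Λ)`) and `Γ ≥ Γ₁(consts, R_b, b)`. -/
def BallRateRowNearStraightLS : Prop :=
  ∀ (N : ℕ) (δ ρ K Λ Rw cg θ₀ KA : ℝ), 0 < N → 0 < δ → 0 < ρ → 0 < Rw → 0 < cg → 0 < θ₀ →
    ∃ Rb₀ : ℝ, 0 < Rb₀ ∧ ∀ Rb : ℝ, 0 < Rb → Rb ≤ Rb₀ → ∀ b : ℝ, ∃ (cα Γ₁ : ℝ), 0 < cα ∧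
      ∀ Γ : ℝ, Γ₁ ≤ Γ → ∀ (γ : Fin N → ℝ) (α : ℝ) (X : Fin N → ℝ → EuclideanSpace ℝ (Fin 3)) (w : Fin N → ℝ → ℝ)
        (c : Fin N → ℝ) (Aa : Fin N → ℝ → ℝ),
        FlatJ1L N δ ρ K Λ Rw Rb cg θ₀ KA Γ γ α X w c Aa → NearStraightJ1G N Λ Rb X w Aa →
          BallRateRowJ1L N 0 b cα Rb Γ γ α X w c Aa

/-! ## §2  The stubs (the ONLY sorries of this file) -/

/-- STUB (piece 1, stmt-NavierStokesRegularity-23320; XL, the heart — BY NAME as in the skeleton of record; its own skeleton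
`filament-plan/lines/TangentSkeletonNearStraightL/child_tangent_analytic_strip_L.lean`).  Not duplicated here. -/
theorem stub_tangentSkeletonL :
    Summit.NavierStokesRegularity.NavierStokesRegularity.Theses.FilamentSkeletonRss.TangentSkeletonNearStraightL := by
  sorry

/-- STUB (J∘) · `stub_clause13InBall` · M–L · in-ball weighted injectivity = item 23612 at `dα = 0` (the lane's in-ball brick programme; the line's own
suggestion: invert the dominant dispersive self-induction part `D` on clamped fields, `‖Y‖_∞ ≲ (4πR_b²/γ_j)·sup|DT·Y|`, instead of energy identities,
which cannot see `D`).  Why it might fail: near-critical Kelvin wavenumbers (`k r_c ≈ 1.1`, where the matched-kernel symbol changes sign) with merely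
`C²` centre-lines; the all-τ-vs-in-ball leak is absent here by design. -/
theorem stub_clause13InBall : Clause13InBallNearStraightLS := by
  sorry

/-- STUB (ρ) · `stub_ballRateRow` · L · the ball-scale rate row by EXACT IN-BALL ADJOINT ANNIHILATORS (cokernel pairing; module docstring).  Why it might
fail: the exact annihilators of the TRUNCATED nonlocal operator carry edge layers of relative width `(log Γ)^{-1/2}` (a Wiener–Hopf problem for the
`u^{-3}` kernel tail) whose `L¹` mass must stay `o(1)` relative to the affine bulk; near-critical Kelvin resonances as for (J∘). -/
theorem stub_ballRateRow : BallRateRowNearStraightLS := by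
  sorry

/-- Piece 3 (stmt-NavierStokesRegularity-23322) — DISCHARGED BY NAME (p667604). No `sorry`. -/
theorem stub_normalBlockL :
    Summit.NavierStokesRegularity.NavierStokesRegularity.Theses.FilamentSkeletonRss.NormalBlockMatchedL :=
  Summit.NavierStokesRegularity.NavierStokesRegularity.Theorems.FilamentSkeletonRssNormalBlockMatchedL.stub_normalBlockL

/-! ## §3  The bordered glue: (J∘) ∧ (ρ) ⟹ clause 13-R (structured form of the route item `Clause13RNearStraightL`, stmt-23612) — sorry-free -/

/-- `‖R‖ ≤ 2‖x‖` for the normal part `R = e₃×x − ⟪e₃×x, t⟫t` of the rotation generator along a unit tangent `t`. [folklore] -/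
theorem norm_bordR_le (x t : EuclideanSpace ℝ (Fin 3)) (ht : ‖t‖ = 1) :
    ‖cross (EuclideanSpace.single 2 1) x - ⟪cross (EuclideanSpace.single 2 1) x, t⟫_ℝ • t‖ ≤ 2 * ‖x‖ := by
  have he : ‖(EuclideanSpace.single (2 : Fin 3) (1 : ℝ))‖ = 1 := by simp
  have hc : ‖cross (EuclideanSpace.single 2 1) x‖ ≤ ‖x‖ := by
    have h := norm_cross_le_norm_mul_norm (EuclideanSpace.single (2 : Fin 3) (1 : ℝ)) x
    rwa [he, one_mul] at h
  have hi : ‖⟪cross (EuclideanSpace.single 2 1) x, t⟫_ℝ • t‖ ≤ ‖x‖ := by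
    rw [norm_smul, Real.norm_eq_abs, ht, mul_one]
    calc |⟪cross (EuclideanSpace.single 2 1) x, t⟫_ℝ| ≤ ‖cross (EuclideanSpace.single 2 1) x‖ * ‖t‖ :=
          abs_real_inner_le_norm _ _
      _ ≤ ‖x‖ := by rw [ht, mul_one]; exact hc
  calc ‖cross (EuclideanSpace.single 2 1) x - ⟪cross (EuclideanSpace.single 2 1) x, t⟫_ℝ • t‖
      ≤ ‖cross (EuclideanSpace.single 2 1) x‖ + ‖⟪cross (EuclideanSpace.single 2 1) x, t⟫_ℝ • t‖ := norm_sub_le _ _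
    _ ≤ ‖x‖ + ‖x‖ := add_le_add hc hi
    _ = 2 * ‖x‖ := by ring

/-- **GLUE** `clause13R_of_inBall_of_rate` (sorry-free): in-ball weighted injectivity (some `a ≥ 0`) and the ball-scale rate row (exponent `0`) give
clause 13-R — delivered with `a := 0`, the same `b`, `cnd := max (cnd·(1 + 2cα)) cα`, `Rb₀ := min`, and the threshold
`Γ ≥ max (max Γ₀ Γ₁) (max 1 (max (exp ((Rw/Rb)²)) (exp (Rb⁻¹ ^ 2))))`.  Bookkeeping: (ρ) gives `|dα|·R_b√(Γ log Γ) ≤ cα L`; the forcing left in the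
column equation is `dα·R_j(τ)` with `‖R_j(τ)‖ ≤ 2‖X_j(τ)‖ ≤ 2R_b√(Γ log Γ)` at in-ball stations, so `DT·Y` obeys the in-ball defect bound `L(1+2cα)`
(`≤ L(1+2cα)(1+|τ−c_j|)^a`), and (J∘) bounds `Y`; `|dα|√Γ ≤ |dα| R_b√(Γ log Γ)` once `R_b√(log Γ) ≥ 1`; `0 ≤ L` because the waist station lies in
the ball (`R_w√Γ ≤ R_b√(Γ log Γ)` for `Γ ≥ exp((R_w/R_b)²)`). -/
theorem clause13R_of_inBall_of_rate (hJ : Clause13InBallNearStraightLS) (hρ : BallRateRowNearStraightLS) :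
    Clause13RNearStraightLS := by
  intro N δ ρ K Λ Rw cg θ₀ KA hN hδ hρ0 hRw hcg hθ₀
  obtain ⟨Rb₀, hRb₀, hJ1⟩ := hJ N δ ρ K Λ Rw cg θ₀ KA hN hδ hρ0 hRw hcg hθ₀
  obtain ⟨Rb₀', hRb₀', hρ1⟩ := hρ N δ ρ K Λ Rw cg θ₀ KA hN hδ hρ0 hRw hcg hθ₀
  refine ⟨min Rb₀ Rb₀', lt_min hRb₀ hRb₀', fun Rb hRb hRble => ?_⟩
  obtain ⟨a, b, cnd, Γ₀, ha, hcnd, hJ2⟩ := hJ1 Rb hRb (hRble.trans (min_le_left _ _))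
  obtain ⟨cα, Γ₁, hcα, hρ2⟩ := hρ1 Rb hRb (hRble.trans (min_le_right _ _)) b
  refine ⟨0, b, max (cnd * (1 + 2 * cα)) cα,
    max (max Γ₀ Γ₁) (max 1 (max (Real.exp ((Rw / Rb) ^ 2)) (Real.exp (Rb⁻¹ ^ 2)))),
    le_rfl, lt_max_of_lt_right hcα, ?_⟩
  intro Γ hΓ γ α X w c Aa hflat hns u v A T hu hv hA hT Y hY1 hY2 hY3 hY4 hY5 dα L hdef
  simp only [max_le_iff] at hΓ
  obtain ⟨⟨hΓ0, hΓ1⟩, h1Γ, hexpΓ, hexpΓ'⟩ := hΓ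
  have hΓpos : 0 < Γ := by linarith
  have hsq : 0 < √Γ := Real.sqrt_pos.2 hΓpos
  -- flat clauses used: unit speed of the centre-lines and the waist position `‖X_j(c_j)‖ ≤ Rw√Γ`
  obtain ⟨-, -, h3, -, -, -, -, -, h9, -⟩ := hflat u v A T hu hv hA hT
  have hunit : ∀ j τ, ‖deriv (X j) τ‖ = 1 := fun j τ => (h3 j).2.2.1 τ
  -- the ball-scale rate row (piece ρ), applied verbatim
  have hrate : |dα| * (Rb * √(Γ * Real.log Γ)) ≤ cα * L :=
    hρ2 Γ hΓ1 γ α X w c Aa hflat hns u v A T hu hv hA hT Y hY1 hY2 hY3 hY4 hY5 dα L hdef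
  -- `exp(x²) ≤ Γ` gives `x ≤ √(log Γ)`
  have hsqlog : ∀ x : ℝ, Real.exp (x ^ 2) ≤ Γ → x ≤ √(Real.log Γ) := fun x hx =>
    (le_abs_self x).trans (Real.abs_le_sqrt ((Real.le_log_iff_exp_le hΓpos).2 hx))
  -- the waist station lies in the ball, hence `0 ≤ L`
  have hRwRb : Rw * √Γ ≤ Rb * √(Γ * Real.log Γ) := by
    have h3' : Rw ≤ √(Real.log Γ) * Rb := (div_le_iff₀ hRb).1 (hsqlog _ hexpΓ)
    calc Rw * √Γ ≤ (√(Real.log Γ) * Rb) * √Γ := mul_le_mul_of_nonneg_right h3' hsq.le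
      _ = Rb * √(Γ * Real.log Γ) := by rw [Real.sqrt_mul hΓpos.le]; ring
  have hL : 0 ≤ L := by
    have hb : ‖X ⟨0, hN⟩ (c ⟨0, hN⟩)‖ ≤ Rb * √(Γ * Real.log Γ) := (h9 _).trans hRwRb
    have h := hdef ⟨0, hN⟩ (c ⟨0, hN⟩) hb
    simp only [Real.rpow_zero, mul_one] at h
    exact (norm_nonneg _).trans h
  -- `√Γ ≤ Rb√(Γ log Γ)` (from `Γ ≥ exp(Rb⁻²)`), so the ball-scale rate bound implies 13-R's `√Γ`-scale one
  have hsqrt_le : √Γ ≤ Rb * √(Γ * Real.log Γ) := by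
    have h1 : 1 ≤ Rb * √(Real.log Γ) := by
      have h := mul_le_mul_of_nonneg_left (hsqlog _ hexpΓ') hRb.le
      rwa [mul_inv_cancel₀ hRb.ne'] at h
    calc √Γ = √Γ * 1 := (mul_one _).symm
      _ ≤ √Γ * (Rb * √(Real.log Γ)) := mul_le_mul_of_nonneg_left h1 hsq.le
      _ = Rb * √(Γ * Real.log Γ) := by rw [Real.sqrt_mul hΓpos.le]; ring
  have hrate' : |dα| * √Γ ≤ cα * L :=
    (mul_le_mul_of_nonneg_left hsqrt_le (abs_nonneg _)).trans hrate
  -- the in-ball defect bound for `DT·Y` itself (absorbing the rate forcing `dα·R_j`, `‖R_j‖ ≤ 2‖X_j‖ ≤ 2Rb√(Γ log Γ)` in the ball)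
  have hdef' : ∀ j τ, ‖X j τ‖ ≤ Rb * √(Γ * Real.log Γ) →
      ‖deriv (fun s:ℝ => T (fun k σ => X k σ + s • Y k σ) j τ) 0‖ ≤ (L * (1 + 2 * cα)) * (1 + |τ - c j|) ^ a := by
    intro j τ hball
    have hD := hdef j τ hball
    simp only [Real.rpow_zero, mul_one] at hD
    have hRv := norm_bordR_le (X j τ) (deriv (X j) τ) (hunit j τ)
    have h1t : 1 ≤ (1 + |τ - c j|) ^ a := Real.one_le_rpow (by linarith [abs_nonneg (τ - c j)]) ha
    have hprod : |dα| * (2 * ‖X j τ‖) ≤ 2 * (cα * L) :=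
      calc |dα| * (2 * ‖X j τ‖) ≤ |dα| * (2 * (Rb * √(Γ * Real.log Γ))) := by gcongr
        _ = 2 * (|dα| * (Rb * √(Γ * Real.log Γ))) := by ring
        _ ≤ 2 * (cα * L) := by linarith [hrate]
    have hpos : 0 ≤ L * (1 + 2 * cα) := mul_nonneg hL (by linarith)
    calc ‖deriv (fun s:ℝ => T (fun k σ => X k σ + s • Y k σ) j τ) 0‖
        ≤ ‖dα • (cross (EuclideanSpace.single 2 1) (X j τ) - ⟪cross (EuclideanSpace.single 2 1) (X j τ), deriv (X j) τ⟫_ℝ • deriv (X j) τ)‖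
          + ‖deriv (fun s:ℝ => T (fun k σ => X k σ + s • Y k σ) j τ) 0
              - dα • (cross (EuclideanSpace.single 2 1) (X j τ) - ⟪cross (EuclideanSpace.single 2 1) (X j τ), deriv (X j) τ⟫_ℝ • deriv (X j) τ)‖ :=
          norm_le_insert' _ _
      _ ≤ |dα| * (2 * ‖X j τ‖) + L := by
          rw [norm_smul, Real.norm_eq_abs]
          exact add_le_add (mul_le_mul_of_nonneg_left hRv (abs_nonneg _)) hD
      _ ≤ (L * (1 + 2 * cα)) * 1 := by linarith [hprod]
      _ ≤ (L * (1 + 2 * cα)) * (1 + |τ - c j|) ^ a := mul_le_mul_of_nonneg_left h1t hpos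
  -- in-ball injectivity (piece J∘) bounds `Y`; collect the constants
  have hYb := hJ2 Γ hΓ0 γ α X w c Aa hflat hns u v A T hu hv hA hT Y hY1 hY2 hY3 hY4 hY5 (L * (1 + 2 * cα)) hdef'
  refine ⟨fun j τ => ?_, ?_⟩
  · have hpos : 0 ≤ L * (1 + |τ - c j|) ^ b := mul_nonneg hL (Real.rpow_nonneg (by positivity) _)
    calc ‖Y j τ‖ ≤ cnd * (L * (1 + 2 * cα)) * (1 + |τ - c j|) ^ b := hYb j τ
      _ = (cnd * (1 + 2 * cα)) * (L * (1 + |τ - c j|) ^ b) := by ring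
      _ ≤ max (cnd * (1 + 2 * cα)) cα * (L * (1 + |τ - c j|) ^ b) := mul_le_mul_of_nonneg_right (le_max_left _ _) hpos
      _ = max (cnd * (1 + 2 * cα)) cα * L * (1 + |τ - c j|) ^ b := by ring
  · calc |dα| * √Γ ≤ cα * L := hrate'
      _ ≤ max (cnd * (1 + 2 * cα)) cα * L := mul_le_mul_of_nonneg_right (le_max_right _ _) hL

/-! ## §4  Composition (sorry-free): the crux `SkeletonJ1R` BY NAME -/

/-- The route item `Clause13RNearStraightL` (stmt-23612) from the two pieces, along the landed `Iff.rfl` certificate. -/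
theorem clause13RNearStraightL_of_pieces (hJ : Clause13InBallNearStraightLS) (hρ : BallRateRowNearStraightLS) :
    Summit.NavierStokesRegularity.NavierStokesRegularity.Theses.FilamentSkeletonRss.Clause13RNearStraightL :=
  route_clause13RNearStraightL_iff.mpr (clause13R_of_inBall_of_rate hJ hρ)

/-- **The skeleton's conclusion: the crux `FilamentSkeletonRss.SkeletonJ1R` (stmt-NavierStokesRegularity-23610) BY NAME.** -/
theorem SkeletonJ1R_of : Summit.NavierStokesRegularity.NavierStokesRegularity.Theses.FilamentSkeletonRss.SkeletonJ1R :=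
  skeletonJ1R_of_children stub_tangentSkeletonL (clause13RNearStraightL_of_pieces stub_clause13InBall stub_ballRateRow) stub_normalBlockL

end Summit.NavierStokesRegularity.NavierStokesRegularity.Cruxes.SkeletonJ1R.AdjointRateR

end
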